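import Literature.Geometry.Lorentzian.AdiabaticTracking
import HarnessLib

/-!
# FREEZE bookkeeping for crux `DriftCapture` (stmt-FinalStateConjecture-17391), line `birth` v4:
# steady labels at every accuracy ⇒ labels pinned at ONE point of the moduli space

The registered stub `stub_pinnedOfSettle` of the skeleton
`Summits/FinalStateConjecture/FinalStateConjecture/Cruxes/DriftCapture/Lines/birth.lean` (v4) is the formal
half of FREEZE. Its physics half `stub_labelsSettle` delivers, for a vacuum Cauchy development `𝒟`,
complexity `(N, m₀, χ)`, window length `L` and a boost bound `C`, at every `δ > 0` and every accuracy
`(ε, R₀)` a tracking chain of `ε`-approximate `N`-Kerr configurations (the six clauses of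
`VacuumCauchyDevelopment.isAdiabaticallyTracked_iff`) which is EVENTUALLY `δ`-STEADY: from some window on the
boost labels have operator norm `≤ C` and the labels `(Mᵢ, aᵢ, Λᵢ)` of any two windows agree to within `δ`.
This file proves that then there is ONE label `(M, a, Λ)` — `Mⱼ ∈ [m₀, m₀⁻¹]`, `|aⱼ| ≤ χ Mⱼ`,
`Λⱼ ∈ O(1,3)` — at which, for every `δ > 0` and every accuracy, some tracking chain is EVENTUALLY
`δ`-PINNED (all late window labels within `δ` of `(M, a, Λ)`).

Proof (Bolzano–Weierstrass): along the cofinal accuracies `(δ, ε, R₀) = ((k+1)⁻¹, (k+1)⁻¹, k)` read the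
label vector of the first steady window of the `k`-th chain in
`V = (Fin N → ℝ) × (Fin N → ℝ) × (Fin N → (E4 →L[ℝ] E4))`; it lies in the closed bounded — hence compact,
`V` being finite-dimensional — set "label box × {`η`-isometries of norm `≤ C`}" (`O(1,3)` is closed in
`E4 →L[ℝ] E4`), so a subsequence converges; the limit boost components are `η`-isometries, which are
invertible (`η` is nondegenerate, `E4` is finite-dimensional), i.e. Lorentz transformations
(`exists_lorentzGroup_coe_eq`); and tracking is monotone in `ε` (up, `ApproximateKerrConfiguration.mono`,
all data kept) and in `R₀` (down), so the `k`-th steady chain, `k` large along the subsequence, serves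
any given coarser accuracy with all its late labels within `(k+1)⁻¹ + δ/2 ≤ δ` of the limit.

No definitions, no named facts. References: Klainerman, C. R. Mécanique 353 (2025), §2.3 (asymptotic
orbital stability at a member of a family); O'Neill 1983, Ch. 9, pp. 233–236 (the Lorentz group).
-/

-- the doubled `FinalStateConjecture.FinalStateConjecture` path component trips dupNamespace
set_option linter.dupNamespace false

noncomputable section

namespace Summit.FinalStateConjecture.FinalStateConjecture.Theorems.RenormalisedDrift.DriftCapture

open Set Filter Topology
open scoped Manifold ContDiff ENNReal
open Literature.Geometry.Lorentzian

/-- **An `η`-isometric continuous linear self-map of `E4` is a Lorentz transformation.** If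
`T : E4 →L[ℝ] E4` preserves the Minkowski form, `η(Tv, Tw) = η(v, w)`, then `T` is injective (`η` is
nondegenerate), hence bijective (`E4` is finite-dimensional), and the resulting continuous linear
equivalence lies in `lorentzGroup` with underlying map `T`. O'Neill 1983, Ch. 9, p. 233. [folklore] -/
theorem exists_lorentzGroup_coe_eq (T : E4 →L[ℝ] E4)
    (hT : ∀ v w, Minkowski.bilin (T v) (T w) = Minkowski.bilin v w) :
    ∃ Λ : lorentzGroup, ((Λ : E4 ≃L[ℝ] E4) : E4 →L[ℝ] E4) = T := by
  have hinj : Function.Injective T := by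
    intro v v' hvv'
    have h0 : T (v - v') = 0 := by rw [map_sub, hvv', sub_self]
    have : v - v' = 0 := Minkowski.bilin_nondegenerate (v - v') fun w ↦ by
      rw [← hT, h0]; simp
    exact sub_eq_zero.1 this
  have hsurj : Function.Surjective T :=
    (LinearMap.injective_iff_surjective (f := (T : E4 →ₗ[ℝ] E4))).1 hinj
  let e : E4 ≃L[ℝ] E4 :=
    ContinuousLinearEquiv.ofBijective T (LinearMap.ker_eq_bot.2 hinj) (LinearMap.range_eq_top.2 hsurj)
  have he : (e : E4 →L[ℝ] E4) = T := ContinuousLinearEquiv.coe_ofBijective _ _ _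
  refine ⟨⟨e, fun v w ↦ ?_⟩, he⟩
  have hv : e v = T v := by rw [← he]; rfl
  have hw : e w = T w := by rw [← he]; rfl
  rw [hv, hw, hT]

/-- The **label set** "moduli box × (`η`-isometries of operator norm `≤ C`)" in
`(Fin N → ℝ) × (Fin N → ℝ) × (Fin N → (E4 →L[ℝ] E4))` is closed: every clause is a non-strict inequality
or an equation between continuous functions of the label vector (evaluation of a continuous linear map at a
fixed vector is continuous). O'Neill 1983, Ch. 9, p. 233 (`O(1,3)` is closed). [folklore] -/
theorem isClosed_labelSet (N : ℕ) (m₀ χ C : ℝ) :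
    IsClosed {p : (Fin N → ℝ) × (Fin N → ℝ) × (Fin N → (E4 →L[ℝ] E4)) |
      (∀ j, m₀ ≤ p.1 j ∧ p.1 j ≤ m₀⁻¹ ∧ |p.2.1 j| ≤ χ * p.1 j) ∧
      ∀ j, (∀ v w, Minkowski.bilin (p.2.2 j v) (p.2.2 j w) = Minkowski.bilin v w) ∧ ‖p.2.2 j‖ ≤ C} := by
  have hev : ∀ (j : Fin N) (v : E4),
      Continuous fun p : (Fin N → ℝ) × (Fin N → ℝ) × (Fin N → (E4 →L[ℝ] E4)) ↦ p.2.2 j v :=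
    fun j v ↦ (ContinuousLinearMap.apply ℝ E4 v).continuous.comp
      ((continuous_apply j).comp (continuous_snd.comp continuous_snd))
  have h1 : ∀ j : Fin N, Continuous fun p : (Fin N → ℝ) × (Fin N → ℝ) × (Fin N → (E4 →L[ℝ] E4)) ↦
      p.1 j := fun j ↦ (continuous_apply j).comp continuous_fst
  have h2 : ∀ j : Fin N, Continuous fun p : (Fin N → ℝ) × (Fin N → ℝ) × (Fin N → (E4 →L[ℝ] E4)) ↦
      p.2.1 j := fun j ↦ (continuous_apply j).comp (continuous_fst.comp continuous_snd)
  have h3 : ∀ j : Fin N, Continuous fun p : (Fin N → ℝ) × (Fin N → ℝ) × (Fin N → (E4 →L[ℝ] E4)) ↦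
      p.2.2 j := fun j ↦ (continuous_apply j).comp (continuous_snd.comp continuous_snd)
  have hb : ∀ (j : Fin N) (v w : E4),
      Continuous fun p : (Fin N → ℝ) × (Fin N → ℝ) × (Fin N → (E4 →L[ℝ] E4)) ↦
        Minkowski.bilin (p.2.2 j v) (p.2.2 j w) :=
    fun j v w ↦ (Minkowski.bilin.continuous.comp (hev j v)).clm_apply (hev j w)
  simp only [setOf_and, setOf_forall]
  refine (isClosed_iInter fun j ↦ (isClosed_le continuous_const (h1 j)).inter
    ((isClosed_le (h1 j) continuous_const).inter
      (isClosed_le ((h2 j).abs) (continuous_const.mul (h1 j))))).inter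
    (isClosed_iInter fun j ↦ (isClosed_iInter fun v ↦ isClosed_iInter fun w ↦
      isClosed_eq (hb j v w) continuous_const).inter
        (isClosed_le ((h3 j).norm) continuous_const))

/-- The label set is **bounded**: masses lie in `[m₀, m₀⁻¹]`, spins satisfy `|aⱼ| ≤ χ Mⱼ ≤ |χ| max(|m₀|, |m₀⁻¹|)`,
boosts have norm `≤ C`. [folklore] -/
theorem isBounded_labelSet (N : ℕ) (m₀ χ C : ℝ) :
    Bornology.IsBounded {p : (Fin N → ℝ) × (Fin N → ℝ) × (Fin N → (E4 →L[ℝ] E4)) |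
      (∀ j, m₀ ≤ p.1 j ∧ p.1 j ≤ m₀⁻¹ ∧ |p.2.1 j| ≤ χ * p.1 j) ∧
      ∀ j, (∀ v w, Minkowski.bilin (p.2.2 j v) (p.2.2 j w) = Minkowski.bilin v w) ∧ ‖p.2.2 j‖ ≤ C} := by
  rw [isBounded_iff_forall_norm_le]
  set B₁ : ℝ := max |m₀| |m₀⁻¹| with hB₁
  have hB₁0 : 0 ≤ B₁ := le_max_of_le_left (abs_nonneg _)
  refine ⟨max B₁ (max (|χ| * B₁) |C|), fun p hp ↦ ?_⟩
  obtain ⟨hp1, hp2⟩ := hp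
  have hm : ∀ j, |p.1 j| ≤ B₁ := fun j ↦ abs_le_max_abs_abs (hp1 j).1 (hp1 j).2.1
  rw [Prod.norm_def, Prod.norm_def]
  refine max_le_max ?_ (max_le_max ?_ ?_)
  · exact (pi_norm_le_iff_of_nonneg hB₁0).2 fun j ↦ by rw [Real.norm_eq_abs]; exact hm j
  · refine (pi_norm_le_iff_of_nonneg (mul_nonneg (abs_nonneg _) hB₁0)).2 fun j ↦ ?_
    rw [Real.norm_eq_abs]
    calc |p.2.1 j| ≤ χ * p.1 j := (hp1 j).2.2
      _ ≤ |χ * p.1 j| := le_abs_self _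
      _ = |χ| * |p.1 j| := abs_mul _ _
      _ ≤ |χ| * B₁ := mul_le_mul_of_nonneg_left (hm j) (abs_nonneg _)
  · exact (pi_norm_le_iff_of_nonneg (abs_nonneg _)).2 fun j ↦ (hp2 j).2.trans (le_abs_self _)

/-- **FREEZE bookkeeping — steady at every accuracy ⇒ pinned at one point (Bolzano–Weierstrass).**
The registered stub `stub_pinnedOfSettle` of crux `DriftCapture`, line `birth` v4 (statement verbatim): for
any vacuum Cauchy development `𝒟`, hole number `N`, bounds `m₀`, `χ`, window length `L` and boost bound `C`, if
for every `δ > 0` and every accuracy `(ε, R₀)`, `0 < ε`, there is a tracking chain at `(ε, L, R₀)` with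
complexity `(N, m₀, χ)` (radii, complexity, chaining, exhaustion, pinning of `O`, covering) which is
eventually `δ`-steady with boosts bounded by `C`, then there is ONE point `(M, a, Λ)` of the moduli space
(`Mⱼ ∈ [m₀, m₀⁻¹]`, `|aⱼ| ≤ χ Mⱼ`, `Λⱼ ∈ O(1,3)`) such that for every `δ > 0` and every accuracy some tracking
chain at `(ε, L, R₀)` is eventually `δ`-pinned at `(M, a, Λ)`. See the module docstring for the proof.
Klainerman, C. R. Mécanique 353 (2025), §2.3. [folklore] -/
theorem stub_pinnedOfSettle : ∀ {X : Type} [TopologicalSpace X] [ChartedSpace E3 X] [IsManifold (𝓡 3) ((⊤ : ℕ∞) : WithTop ℕ∞) X] [ConnectedSpace X] {D : InitialDataSet (𝓡 3) X} (𝒟 : VacuumCauchyDevelopment D) (N : ℕ) (m₀ χ L C : ℝ), (∀ δ : ℝ, 0 < δ → ∀ (ε : ENNReal) (R₀ : ℝ), 0 < ε → ∃ (R : ℕ → ℝ) (O : Set 𝒟.carrier) (c : ∀ n : ℕ, ApproximateKerrConfiguration 𝒟.toSpacetime O 2 ε 0 L (R n)), (∀ n, R₀ ≤ R n) ∧ Tendsto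 R atTop atTop ∧ (∀ n, (c n).N = N) ∧ (∀ n (i : Fin (c n).N), m₀ ≤ (c n).mass i ∧ (c n).mass i ≤ m₀⁻¹ ∧ |(c n).spin i| ≤ χ * (c n).mass i) ∧ (∀ n, (c (n + 1)).certifiedSlab 0 ⊆ (c n).windowImage) ∧ (∀ K : Set 𝒟.carrier, IsCompact K → ∃ n₀ : ℕ, ∀ n, n₀ ≤ n → Disjoint (c n).windowImage (𝒟.metric.causalPast 𝒟.timeOrientation K)) ∧ O = 𝒟.toCauchyDevelopment.exteriorOf (⋃ n, (c n).windowImage) ∧ O ⊆ 𝒟.metric.causalPast 𝒟.timeOrientation ((c 0).certifiedSlab 0) ∪ ⋃ n, (c n).windowImage ∧ ∃ n₀ : ℕ, (∀ n, n₀ ≤ n → ∀ i : Fin (c n).N, ‖((((c n).motion i).1 : E4 ≃L[ℝ] E4) : E4 →L[ℝ] E4)‖ ≤ C) ∧ (∀ n n' : ℕ, n₀ ≤ n → n₀ ≤ n' → ∀ (i : Fin (c n).N) (i' : Fin (c n').N), (i : ℕ) = (i' : ℕ) → |(c n).mass i - (c n').mass i'| ≤ δ ∧ |(c n).spin i - (c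 n').spin i'| ≤ δ ∧ ‖((((c n).motion i).1 : E4 ≃L[ℝ] E4) : E4 →L[ℝ] E4) - ((((c n').motion i').1 : E4 ≃L[ℝ] E4) : E4 →L[ℝ] E4)‖ ≤ δ)) → ∃ (M a : Fin N → ℝ) (Λ : Fin N → lorentzGroup), (∀ j, m₀ ≤ M j ∧ M j ≤ m₀⁻¹ ∧ |a j| ≤ χ * M j) ∧ ∀ δ : ℝ, 0 < δ → ∀ (ε : ENNReal) (R₀ : ℝ), 0 < ε → ∃ (R : ℕ → ℝ) (O : Set 𝒟.carrier) (c : ∀ n : ℕ, ApproximateKerrConfiguration 𝒟.toSpacetime O 2 ε 0 L (R n)), (∀ n, R₀ ≤ R n) ∧ Tendsto R atTop atTop ∧ (∀ n, (c n).N = N) ∧ (∀ n (i : Fin (c n).N), m₀ ≤ (c n).mass i ∧ (c n).mass i ≤ m₀⁻¹ ∧ |(c n).spin i| ≤ χ * (c n).mass i) ∧ (∀ n, (c (n + 1)).certifiedSlab 0 ⊆ (c n).windowImage) ∧ (∀ K : Set 𝒟.carrier, IsCompact K → ∃ n₀ : ℕ, ∀ n, n₀ ≤ n → Disjoint (c n).windowImage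 (𝒟.metric.causalPast 𝒟.timeOrientation K)) ∧ O = 𝒟.toCauchyDevelopment.exteriorOf (⋃ n, (c n).windowImage) ∧ O ⊆ 𝒟.metric.causalPast 𝒟.timeOrientation ((c 0).certifiedSlab 0) ∪ ⋃ n, (c n).windowImage ∧ ∃ n₀ : ℕ, ∀ n, n₀ ≤ n → ∀ (i : Fin (c n).N) (j : Fin N), (i : ℕ) = (j : ℕ) → |(c n).mass i - M j| ≤ δ ∧ |(c n).spin i - a j| ≤ δ ∧ ‖((((c n).motion i).1 : E4 ≃L[ℝ] E4) : E4 →L[ℝ] E4) - (((Λ j : E4 ≃L[ℝ] E4)) : E4 →L[ℝ] E4)‖ ≤ δ := by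
  intro X _ _ _ _ D 𝒟 N m₀ χ L C h
  -- Step 1: the cofinal sequence of accuracies `(δ, ε, R₀) = ((k+1)⁻¹, (k+1)⁻¹, k)`
  have hδk : ∀ k : ℕ, (0 : ℝ) < ((k : ℝ) + 1)⁻¹ := fun k ↦ inv_pos.2 (Nat.cast_add_one_pos k)
  have hεk : ∀ k : ℕ, (0 : ℝ≥0∞) < ((k : ℝ≥0∞) + 1)⁻¹ := fun k ↦
    ENNReal.inv_pos.2 (ENNReal.add_ne_top.2 ⟨ENNReal.natCast_ne_top k, ENNReal.one_ne_top⟩)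
  choose R O c hR hRt hN hM hch hex hO hcov n₀ hC hst using
    fun k : ℕ ↦ h ((k : ℝ) + 1)⁻¹ (hδk k) (((k : ℝ≥0∞) + 1)⁻¹) (k : ℝ) (hεk k)
  -- Step 2: the label vector of the first steady window of the `k`-th chain
  let q : ℕ → (Fin N → ℝ) × (Fin N → ℝ) × (Fin N → (E4 →L[ℝ] E4)) := fun k ↦
    (fun j ↦ (c k (n₀ k)).mass (Fin.cast (hN k (n₀ k)).symm j),
      fun j ↦ (c k (n₀ k)).spin (Fin.cast (hN k (n₀ k)).symm j),
      fun j ↦ ((((c k (n₀ k)).motion (Fin.cast (hN k (n₀ k)).symm j)).1 : E4 ≃L[ℝ] E4) : E4 →L[ℝ] E4))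
  -- Step 3: the compact set in which the label vectors live
  let S : Set ((Fin N → ℝ) × (Fin N → ℝ) × (Fin N → (E4 →L[ℝ] E4))) :=
    {p | (∀ j, m₀ ≤ p.1 j ∧ p.1 j ≤ m₀⁻¹ ∧ |p.2.1 j| ≤ χ * p.1 j) ∧
      ∀ j, (∀ v w, Minkowski.bilin (p.2.2 j v) (p.2.2 j w) = Minkowski.bilin v w) ∧ ‖p.2.2 j‖ ≤ C}
  have hq : ∀ k, q k ∈ S := fun k ↦ by
    refine ⟨fun j ↦ hM k (n₀ k) _, fun j ↦ ⟨fun v w ↦ ?_, hC k (n₀ k) le_rfl _⟩⟩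
    exact ((c k (n₀ k)).motion (Fin.cast (hN k (n₀ k)).symm j)).1.2 v w
  have hSc : IsClosed S := isClosed_labelSet N m₀ χ C
  have hSb : Bornology.IsBounded S := isBounded_labelSet N m₀ χ C
  -- Step 4: a convergent subsequence and the limit label
  obtain ⟨p, hp, φ, hφ, hlim⟩ := (Metric.isCompact_of_isClosed_isBounded hSc hSb).tendsto_subseq hq
  choose Λ hΛ using fun j ↦ exists_lorentzGroup_coe_eq (p.2.2 j) (hp.2 j).1
  refine ⟨p.1, p.2.1, Λ, hp.1, fun δ hδ ε R₀ hε ↦ ?_⟩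
  -- Step 5: a late enough member of the subsequence serves the accuracy `(δ, ε, R₀)`
  obtain ⟨K₁, hK₁⟩ := Metric.tendsto_atTop.1 hlim (δ / 2) (half_pos hδ)
  obtain ⟨K₂, hK₂⟩ := exists_nat_gt (2 / δ)
  obtain ⟨nε, hnε⟩ := ENNReal.exists_inv_nat_lt hε.ne'
  obtain ⟨K₄, hK₄⟩ := exists_nat_ge R₀
  set k : ℕ := max (max K₁ K₂) (max nε K₄) with hk
  set m : ℕ := φ k with hm
  have hkm : k ≤ m := hφ.id_le k
  have hK₁k : K₁ ≤ k := (le_max_left _ _).trans (le_max_left _ _)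
  have hK₂m : (K₂ : ℝ) ≤ m := Nat.cast_le.2 (((le_max_right _ _).trans (le_max_left _ _)).trans hkm)
  have hnεm : nε ≤ m := ((le_max_left _ _).trans (le_max_right _ _)).trans hkm
  have hK₄m : (K₄ : ℝ) ≤ m := Nat.cast_le.2 (((le_max_right _ _).trans (le_max_right _ _)).trans hkm)
  -- (a) the steadiness scale `(m+1)⁻¹ ≤ δ/2`
  have hδm : ((m : ℝ) + 1)⁻¹ ≤ δ / 2 := by
    have h2δ : 0 < 2 / δ := div_pos two_pos hδ
    calc ((m : ℝ) + 1)⁻¹ ≤ (2 / δ)⁻¹ :=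
          inv_anti₀ h2δ ((hK₂.le.trans hK₂m).trans (le_add_of_nonneg_right zero_le_one))
      _ = δ / 2 := inv_div _ _
  -- (b) the accuracy `(m+1)⁻¹ ≤ ε`
  have hεm : ((m : ℝ≥0∞) + 1)⁻¹ ≤ ε := by
    refine (ENNReal.inv_le_inv.2 ?_).trans hnε.le
    exact (Nat.cast_le.2 hnεm).trans le_self_add
  -- (c) the radius floor `R₀ ≤ m`
  have hRm : R₀ ≤ (m : ℝ) := hK₄.trans hK₄m
  -- (d) the distance of the `m`-th label vector to the limit
  have hdist : ‖q m - p‖ < δ / 2 := by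
    rw [← dist_eq_norm]
    exact hK₁ k hK₁k
  refine ⟨R m, O m, fun n ↦ (c m n).mono hεm, fun n ↦ hRm.trans (hR m n), hRt m, hN m, hM m, hch m,
    hex m, hO m, hcov m, n₀ m, fun n hn i j hij ↦ ?_⟩
  -- the comparison window: index `j` read in the first steady window `n₀ m` of the `m`-th chain
  set i₀ : Fin (c m (n₀ m)).N := Fin.cast (hN m (n₀ m)).symm j with hi₀
  have hii₀ : (i : ℕ) = (i₀ : ℕ) := hij
  obtain ⟨h₁, h₂, h₃⟩ := hst m n (n₀ m) hn le_rfl i i₀ hii₀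
  -- componentwise distances to the limit are bounded by `‖q m - p‖`
  have hq1 : |(c m (n₀ m)).mass i₀ - p.1 j| ≤ δ / 2 := by
    have := (norm_le_pi_norm ((q m).1 - p.1) j).trans ((norm_fst_le (q m - p)).trans hdist.le)
    rwa [Pi.sub_apply, Real.norm_eq_abs] at this
  have hq2 : |(c m (n₀ m)).spin i₀ - p.2.1 j| ≤ δ / 2 := by
    have := (norm_le_pi_norm ((q m).2.1 - p.2.1) j).trans
      ((norm_fst_le (q m - p).2).trans ((norm_snd_le (q m - p)).trans hdist.le))
    rwa [Pi.sub_apply, Real.norm_eq_abs] at this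
  have hq3 : ‖((((c m (n₀ m)).motion i₀).1 : E4 ≃L[ℝ] E4) : E4 →L[ℝ] E4) -
      (((Λ j : E4 ≃L[ℝ] E4)) : E4 →L[ℝ] E4)‖ ≤ δ / 2 := by
    have := (norm_le_pi_norm ((q m).2.2 - p.2.2) j).trans
      ((norm_snd_le (q m - p).2).trans ((norm_snd_le (q m - p)).trans hdist.le))
    rwa [Pi.sub_apply, ← hΛ j] at this
  change |(c m n).mass i - p.1 j| ≤ δ ∧ |(c m n).spin i - p.2.1 j| ≤ δ ∧
    ‖((((c m n).motion i).1 : E4 ≃L[ℝ] E4) : E4 →L[ℝ] E4) - (((Λ j : E4 ≃L[ℝ] E4)) : E4 →L[ℝ] E4)‖ ≤ δ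
  refine ⟨?_, ?_, ?_⟩
  · calc |(c m n).mass i - p.1 j|
          ≤ |(c m n).mass i - (c m (n₀ m)).mass i₀| + |(c m (n₀ m)).mass i₀ - p.1 j| := abs_sub_le _ _ _
      _ ≤ δ / 2 + δ / 2 := add_le_add (h₁.trans hδm) hq1
      _ = δ := add_halves δ
  · calc |(c m n).spin i - p.2.1 j|
          ≤ |(c m n).spin i - (c m (n₀ m)).spin i₀| + |(c m (n₀ m)).spin i₀ - p.2.1 j| := abs_sub_le _ _ _
      _ ≤ δ / 2 + δ / 2 := add_le_add (h₂.trans hδm) hq2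
      _ = δ := add_halves δ
  · calc ‖((((c m n).motion i).1 : E4 ≃L[ℝ] E4) : E4 →L[ℝ] E4) - (((Λ j : E4 ≃L[ℝ] E4)) : E4 →L[ℝ] E4)‖
          ≤ ‖((((c m n).motion i).1 : E4 ≃L[ℝ] E4) : E4 →L[ℝ] E4) -
              ((((c m (n₀ m)).motion i₀).1 : E4 ≃L[ℝ] E4) : E4 →L[ℝ] E4)‖ +
            ‖((((c m (n₀ m)).motion i₀).1 : E4 ≃L[ℝ] E4) : E4 →L[ℝ] E4) -
              (((Λ j : E4 ≃L[ℝ] E4)) : E4 →L[ℝ] E4)‖ := norm_sub_le_norm_sub_add_norm_sub _ _ _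
      _ ≤ δ / 2 + δ / 2 := add_le_add (h₃.trans hδm) hq3
      _ = δ := add_halves δ

/-- **Converse bookkeeping: pinned at one point ⇒ steady with bounded boosts.** If at the fixed label
`(M, a, Λ)` there is, for every `δ > 0` and every accuracy `(ε, R₀)`, a tracking chain at `(ε, L, R₀)` with
complexity `(N, m₀, χ)` which is eventually `δ`-pinned at `(M, a, Λ)`, then with the boost bound
`C = ‖Λ‖ + 1` (sup norm of the boost labels) there is, for every `δ > 0` and every accuracy, a tracking chain
which is eventually `δ`-steady with boosts bounded by `C` (the `δ/2 ⊓ 1`-pinned chain: two late labels are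
both within `δ/2` of the common label). Together with `stub_pinnedOfSettle` this shows that the v4 split of
FREEZE of crux `DriftCapture` loses nothing: "steady at every accuracy with a uniform boost bound" and
"eventually pinned at one point of the moduli space at every accuracy" are equivalent. [folklore] -/
theorem labelsSettle_of_eventuallyPinned : ∀ {X : Type} [TopologicalSpace X] [ChartedSpace E3 X] [IsManifold (𝓡 3) ((⊤ : ℕ∞) : WithTop ℕ∞) X] [ConnectedSpace X] {D : InitialDataSet (𝓡 3) X} (𝒟 : VacuumCauchyDevelopment D) (N : ℕ) (m₀ χ L : ℝ) (M a : Fin N → ℝ) (Λ : Fin N → lorentzGroup), (∀ δ : ℝ, 0 < δ → ∀ (ε : ENNReal) (R₀ : ℝ), 0 < ε → ∃ (R : ℕ → ℝ) (O : Set 𝒟.carrier) (c : ∀ n : ℕ, ApproximateKerrConfiguration 𝒟.toSpacetime O 2 ε 0 L (R n)), (∀ n, R₀ ≤ R n) ∧ Tendsto R atTop atTop ∧ (∀ n, (c n).N = N) ∧ (∀ n (i : Fin (c n).N), m₀ ≤ (c n).mass i ∧ (c n).mass i ≤ m₀⁻¹ ∧ |(c n).spin i| ≤ χ * (c n).mass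 i) ∧ (∀ n, (c (n + 1)).certifiedSlab 0 ⊆ (c n).windowImage) ∧ (∀ K : Set 𝒟.carrier, IsCompact K → ∃ n₀ : ℕ, ∀ n, n₀ ≤ n → Disjoint (c n).windowImage (𝒟.metric.causalPast 𝒟.timeOrientation K)) ∧ O = 𝒟.toCauchyDevelopment.exteriorOf (⋃ n, (c n).windowImage) ∧ O ⊆ 𝒟.metric.causalPast 𝒟.timeOrientation ((c 0).certifiedSlab 0) ∪ ⋃ n, (c n).windowImage ∧ ∃ n₀ : ℕ, ∀ n, n₀ ≤ n → ∀ (i : Fin (c n).N) (j : Fin N), (i : ℕ) = (j : ℕ) → |(c n).mass i - M j| ≤ δ ∧ |(c n).spin i - a j| ≤ δ ∧ ‖((((c n).motion i).1 : E4 ≃L[ℝ] E4) : E4 →L[ℝ] E4) - (((Λ j : E4 ≃L[ℝ] E4)) : E4 →L[ℝ] E4)‖ ≤ δ) → ∃ C : ℝ, ∀ δ : ℝ, 0 < δ → ∀ (ε : ENNReal) (R₀ : ℝ), 0 < ε → ∃ (R : ℕ → ℝ) (O : Set 𝒟.carrier) (c : ∀ n : ℕ, ApproximateKerrConfiguration 𝒟.toSpacetime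 O 2 ε 0 L (R n)), (∀ n, R₀ ≤ R n) ∧ Tendsto R atTop atTop ∧ (∀ n, (c n).N = N) ∧ (∀ n (i : Fin (c n).N), m₀ ≤ (c n).mass i ∧ (c n).mass i ≤ m₀⁻¹ ∧ |(c n).spin i| ≤ χ * (c n).mass i) ∧ (∀ n, (c (n + 1)).certifiedSlab 0 ⊆ (c n).windowImage) ∧ (∀ K : Set 𝒟.carrier, IsCompact K → ∃ n₀ : ℕ, ∀ n, n₀ ≤ n → Disjoint (c n).windowImage (𝒟.metric.causalPast 𝒟.timeOrientation K)) ∧ O = 𝒟.toCauchyDevelopment.exteriorOf (⋃ n, (c n).windowImage) ∧ O ⊆ 𝒟.metric.causalPast 𝒟.timeOrientation ((c 0).certifiedSlab 0) ∪ ⋃ n, (c n).windowImage ∧ ∃ n₀ : ℕ, (∀ n, n₀ ≤ n → ∀ i : Fin (c n).N, ‖((((c n).motion i).1 : E4 ≃L[ℝ] E4) : E4 →L[ℝ] E4)‖ ≤ C) ∧ (∀ n n' : ℕ, n₀ ≤ n → n₀ ≤ n' → ∀ (i : Fin (c n).N) (i' : Fin (c n').N), (i : ℕ) = (i' : ℕ)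 → |(c n).mass i - (c n').mass i'| ≤ δ ∧ |(c n).spin i - (c n').spin i'| ≤ δ ∧ ‖((((c n).motion i).1 : E4 ≃L[ℝ] E4) : E4 →L[ℝ] E4) - ((((c n').motion i').1 : E4 ≃L[ℝ] E4) : E4 →L[ℝ] E4)‖ ≤ δ) := by
  intro X _ _ _ _ D 𝒟 N m₀ χ L M a Λ h
  -- the boost bound: sup norm of the fixed boost labels plus the pinning slack `1`
  refine ⟨‖fun j ↦ ((Λ j : E4 ≃L[ℝ] E4) : E4 →L[ℝ] E4)‖ + 1, fun δ hδ ε R₀ hε ↦ ?_⟩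
  have hδ' : 0 < min (δ / 2) 1 := lt_min (half_pos hδ) one_pos
  obtain ⟨R, O, c, hR, hRt, hN, hM, hch, hex, hO, hcov, n₀, hpin⟩ := h (min (δ / 2) 1) hδ' ε R₀ hε
  refine ⟨R, O, c, hR, hRt, hN, hM, hch, hex, hO, hcov, n₀, fun n hn i ↦ ?_, fun n n' hn hn' i i' hii' ↦ ?_⟩
  · -- boosts of late windows are within `1` of the fixed boosts
    have hi : (i : ℕ) < N := i.isLt.trans_eq (hN n)
    obtain ⟨-, -, h₃⟩ := hpin n hn i ⟨i, hi⟩ rfl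
    have hΛ : ‖((Λ ⟨i, hi⟩ : E4 ≃L[ℝ] E4) : E4 →L[ℝ] E4)‖ ≤
        ‖fun j ↦ ((Λ j : E4 ≃L[ℝ] E4) : E4 →L[ℝ] E4)‖ :=
      norm_le_pi_norm (fun j ↦ ((Λ j : E4 ≃L[ℝ] E4) : E4 →L[ℝ] E4)) ⟨i, hi⟩
    calc ‖((((c n).motion i).1 : E4 ≃L[ℝ] E4) : E4 →L[ℝ] E4)‖
        ≤ ‖((((c n).motion i).1 : E4 ≃L[ℝ] E4) : E4 →L[ℝ] E4) - ((Λ ⟨i, hi⟩ : E4 ≃L[ℝ] E4) : E4 →L[ℝ] E4)‖ +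
            ‖((Λ ⟨i, hi⟩ : E4 ≃L[ℝ] E4) : E4 →L[ℝ] E4)‖ := norm_le_norm_sub_add _ _
      _ ≤ 1 + ‖fun j ↦ ((Λ j : E4 ≃L[ℝ] E4) : E4 →L[ℝ] E4)‖ := add_le_add (h₃.trans (min_le_right _ _)) hΛ
      _ = ‖fun j ↦ ((Λ j : E4 ≃L[ℝ] E4) : E4 →L[ℝ] E4)‖ + 1 := add_comm _ _
  · -- two late labels are both within `δ/2` of the fixed label with the common index
    have hi : (i : ℕ) < N := i.isLt.trans_eq (hN n)
    obtain ⟨h₁, h₂, h₃⟩ := hpin n hn i ⟨i, hi⟩ rfl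
    obtain ⟨h₁', h₂', h₃'⟩ := hpin n' hn' i' ⟨i, hi⟩ hii'.symm
    have hle : min (δ / 2) 1 + min (δ / 2) 1 ≤ δ :=
      (add_le_add (min_le_left _ _) (min_le_left _ _)).trans_eq (add_halves δ)
    refine ⟨?_, ?_, ?_⟩
    · calc |(c n).mass i - (c n').mass i'|
          ≤ |(c n).mass i - M ⟨i, hi⟩| + |M ⟨i, hi⟩ - (c n').mass i'| := abs_sub_le _ _ _
        _ ≤ min (δ / 2) 1 + min (δ / 2) 1 := add_le_add h₁ (by rw [abs_sub_comm]; exact h₁')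
        _ ≤ δ := hle
    · calc |(c n).spin i - (c n').spin i'|
          ≤ |(c n).spin i - a ⟨i, hi⟩| + |a ⟨i, hi⟩ - (c n').spin i'| := abs_sub_le _ _ _
        _ ≤ min (δ / 2) 1 + min (δ / 2) 1 := add_le_add h₂ (by rw [abs_sub_comm]; exact h₂')
        _ ≤ δ := hle
    · calc ‖((((c n).motion i).1 : E4 ≃L[ℝ] E4) : E4 →L[ℝ] E4) - ((((c n').motion i').1 : E4 ≃L[ℝ] E4) : E4 →L[ℝ] E4)‖
          ≤ ‖((((c n).motion i).1 : E4 ≃L[ℝ] E4) : E4 →L[ℝ] E4) - ((Λ ⟨i, hi⟩ : E4 ≃L[ℝ] E4) : E4 →L[ℝ] E4)‖ +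
              ‖((Λ ⟨i, hi⟩ : E4 ≃L[ℝ] E4) : E4 →L[ℝ] E4) - ((((c n').motion i').1 : E4 ≃L[ℝ] E4) : E4 →L[ℝ] E4)‖ :=
            norm_sub_le_norm_sub_add_norm_sub _ _ _
        _ ≤ min (δ / 2) 1 + min (δ / 2) 1 := add_le_add h₃ (by rw [norm_sub_rev]; exact h₃')
        _ ≤ δ := hle

end Summit.FinalStateConjecture.FinalStateConjecture.Theorems.RenormalisedDrift.DriftCapture

end
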